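import Literature.NumberTheory.ModularForms.InterpolationKernels
import Literature.NumberTheory.ModularForms.QAsymptoticsTheta
import HarnessLib

/-!
# The bound (4.14) for `𝒦₋^{(8)}`: `𝒦₋^{(8)}(τ, z) = O(|τ| e^{−2π Im τ})` as `Im τ → ∞`

Cohn–Kumar–Miller–Radchenko–Viazovska, arXiv:1902.05438, §4.4 (4.14): "for fixed `z` and `τ → ∞`,
`𝒦₊^{(8)}(τ,z), 𝒦₋^{(8)}(τ,z) = O(|τ e^{2πiτ}|)`".

PROVED here for `𝒦₋^{(8)}` and fixed `z` (`kernelMinus8_isBigO`). With `A(z) = E₈ψ̃₂ − E₆ψ̃₄`,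
`𝒦₋^{(8)} = (c/Δ(z))·[ −2𝔠E₄E₁₀(z)𝓛(z)/J + (ψ₂ − ψ₄)(f₂/J)A(z) + ψ₄((f₂ − j)/J·A(z) + 𝔠E₈(z)ψ̃₂(z)/J) ]`
(`J = j(τ) − j(z)`, `f₂ = E₁₄/Δ`, `c = (2·1728π)⁻¹`, `𝔠 = 1728`), and
* `ψ₂ − ψ₄ = (ξ₂ − ξ₄)𝓛 + (ξ₂|S − ξ₄|S)𝓛_S = O(|τ|e^{−2πy})` by the second-order theta asymptotics
  (`ξ₂ − ξ₄ = O(e^{−2πy})`, `ξ₂|S − ξ₄|S = O(e^{−πy})`, `𝓛 = O(|τ|)`, `𝓛_S = O(e^{−πy})`);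
* `ψ₄ = O(|τ|)`, `(f₂ − j)/J = E₄²(E₆ − E₄)/(ΔJ) = O(e^{−2πy})`, `J⁻¹ = O(e^{−2πy})`, `f₂/J = O(1)`.

## References

* H. Cohn, A. Kumar, S. D. Miller, D. Radchenko, M. Viazovska, Ann. of Math. 196 (2022),
  arXiv:1902.05438, Theorem 4.1 (4), §4.4 (4.14). [CohnEtAl2019]
-/

noncomputable section

open Complex hiding I
open Filter Topology Asymptotics ModularForm SlashInvariantForm EisensteinSeries
open UpperHalfPlane hiding I
open Complex (I)
open scoped Real MatrixGroups ModularForm Manifold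

namespace Literature.NumberTheory.ModularForms

open Literature.NumberTheory.EllipticCurves.ModularForms (kleinJ E₄_cube_eq_kleinJ_mul)

/-! ## Growth of `𝓛`, `ξ`, `ψ` -/

/-- `𝓛(τ) = O(|τ|)` (`𝓛 = πiτ + log 16 + o(1)`). [cite: CohnEtAl2019, §2.1.2 (2.10)] -/
theorem logLambda_isBigO : logLambda =O[atImInfty] fun τ : ℍ => ‖(τ : ℂ)‖ := by
  have h := logLambda_second_order.trans (expDecayHalf_pow_isBigO_pow (m := 2) (n := 0) (by norm_num))
  have h1 : (fun τ : ℍ => logLambda τ - π * I * τ - (Real.log 16 : ℝ) + 8 * qhalf τ) =O[atImInfty]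
      fun τ : ℍ => ‖(τ : ℂ)‖ := by
    refine (h.congr_right fun τ => pow_zero _).trans (IsBigO.of_bound 1 ?_)
    filter_upwards [eventually_one_le_norm_coe] with τ hτ
    simpa using hτ
  have h2 : (fun τ : ℍ => π * I * τ) =O[atImInfty] fun τ : ℍ => ‖(τ : ℂ)‖ :=
    IsBigO.of_bound π (Eventually.of_forall fun τ => by simp [abs_of_pos Real.pi_pos])
  have h3 : (fun _ : ℍ => ((Real.log 16 : ℝ) : ℂ)) =O[atImInfty] fun τ : ℍ => ‖(τ : ℂ)‖ :=
    isBigO_norm_coe_of_bounded (Filter.const_boundedAtFilter _ _)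
  have h4 : (fun τ : ℍ => 8 * qhalf τ) =O[atImInfty] fun τ : ℍ => ‖(τ : ℂ)‖ := by
    refine IsBigO.of_bound 8 ?_
    filter_upwards [eventually_one_le_norm_coe] with τ hτ
    rw [norm_mul, show ‖(8 : ℂ)‖ = 8 by norm_num, norm_qhalf, norm_norm]
    nlinarith [expDecayHalf_le_one τ]
  exact (((h1.add h2).add h3).sub h4).congr_left fun τ => by ring

/-- `𝓛_S = O(e^{−πy})`. [cite: CohnEtAl2019, §2.1.2 (2.10)] -/
theorem logLambdaS_isBigO : logLambdaS =O[atImInfty] fun τ => expDecayHalf τ := by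
  have h := logLambdaS_second_order.trans (expDecayHalf_pow_isBigO (m := 2) (by norm_num))
  have h16 : (fun τ => 16 * qhalf τ) =O[atImInfty] fun τ => expDecayHalf τ := qhalf_isBigO.const_mul_left 16
  exact (h.sub h16).congr_left fun τ => by ring

/-- `U, V, W = O(1)` at `i∞`. [folklore] -/
theorem thetaUVW_isBigO_one :
    thetaU =O[atImInfty] (fun _ : ℍ => (1 : ℝ)) ∧ thetaV =O[atImInfty] (fun _ : ℍ => (1 : ℝ)) ∧
      thetaW =O[atImInfty] (fun _ : ℍ => (1 : ℝ)) :=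
  ⟨tendsto_thetaU.isBigO_one ℝ, tendsto_thetaV.isBigO_one ℝ, tendsto_thetaW.isBigO_one ℝ⟩

/-- **`ξ₂ − ξ₄ = O(e^{−2πy})`**: `U + W − U² − W² + 2V² = −(U−1−8q^{1/2})(U+1) − (W−1+8q^{1/2})(W+1)`
`− 8q^{1/2}(U − W − 16q^{1/2}) + 2V² − 128q`… — every term is `O(e^{−2πy})`. [cite: CohnEtAl2019, §4.4 (4.14)] -/
theorem xi2_sub_xi4_isBigO : (fun τ => xi2 τ - xi4 τ) =O[atImInfty] fun τ => expDecayHalf τ ^ 2 := by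
  obtain ⟨hU1, hV1, hW1⟩ := thetaUVW_isBigO_one
  have hU := thetaU_second_order
  have hW := thetaW_second_order
  have hV := thetaV_second_order.trans (expDecayHalf_pow_isBigO_pow (m := 3) (n := 2) (by norm_num))
  have hq := qhalf_isBigO
  have hq1 : (fun τ => qhalf τ) =O[atImInfty] fun _ : ℍ => (1 : ℝ) :=
    IsBigO.of_bound 1 (Eventually.of_forall fun τ => by simp [norm_qhalf, expDecayHalf_le_one τ])
  have hqq : (fun τ => qhalf τ * qhalf τ) =O[atImInfty] fun τ => expDecayHalf τ ^ 2 := by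
    simpa [sq] using hq.mul hq
  -- with `A = U−1−8b`, `B = W−1+8b`, `V' = V − 16b` (`b = q^{1/2}`):
  -- `ξ₂ − ξ₄ = −(A(1+A) + B(1+B)) − 16b(A − B) + 384b² + 2V'(V' + 32b)`
  have hform : ∀ τ : ℍ, xi2 τ - xi4 τ =
      -((thetaU τ - 1 - 8 * qhalf τ) * (thetaU τ - 8 * qhalf τ) + (thetaW τ - 1 + 8 * qhalf τ) * (thetaW τ + 8 * qhalf τ))
        - 16 * qhalf τ * ((thetaU τ - 1 - 8 * qhalf τ) - (thetaW τ - 1 + 8 * qhalf τ))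
        + 384 * (qhalf τ * qhalf τ)
        + 2 * (thetaV τ - 16 * qhalf τ) * ((thetaV τ - 16 * qhalf τ) + 32 * qhalf τ) := by
    intro τ
    simp only [xi2, xi4, Pi.add_apply, Pi.sub_apply, Pi.mul_apply, Pi.smul_apply, smul_eq_mul]
    ring
  have t1 : (fun τ => (thetaU τ - 1 - 8 * qhalf τ) * (thetaU τ - 8 * qhalf τ)) =O[atImInfty] fun τ => expDecayHalf τ ^ 2 := by
    have hb : (fun τ => thetaU τ - 8 * qhalf τ) =O[atImInfty] fun _ : ℍ => (1 : ℝ) := hU1.sub (hq1.const_mul_left 8)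
    simpa using hU.mul hb
  have t2 : (fun τ => (thetaW τ - 1 + 8 * qhalf τ) * (thetaW τ + 8 * qhalf τ)) =O[atImInfty] fun τ => expDecayHalf τ ^ 2 := by
    have hb : (fun τ => thetaW τ + 8 * qhalf τ) =O[atImInfty] fun _ : ℍ => (1 : ℝ) := hW1.add (hq1.const_mul_left 8)
    simpa using hW.mul hb
  have t3 : (fun τ => 16 * qhalf τ * ((thetaU τ - 1 - 8 * qhalf τ) - (thetaW τ - 1 + 8 * qhalf τ))) =O[atImInfty]
      fun τ => expDecayHalf τ ^ 2 := by
    have := (hq1.mul (hU.sub hW)).const_mul_left 16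
    simpa [mul_assoc] using this
  have t4 : (fun τ => 2 * (thetaV τ - 16 * qhalf τ) * ((thetaV τ - 16 * qhalf τ) + 32 * qhalf τ)) =O[atImInfty]
      fun τ => expDecayHalf τ ^ 2 := by
    have hb : (fun τ => (thetaV τ - 16 * qhalf τ) + 32 * qhalf τ) =O[atImInfty] fun _ : ℍ => (1 : ℝ) :=
      (hV1.sub (hq1.const_mul_left 16)).add (hq1.const_mul_left 32)
    have := (hV.mul hb).const_mul_left 2
    simpa [mul_assoc] using this
  have t5 : (fun τ => 384 * (qhalf τ * qhalf τ)) =O[atImInfty] fun τ => expDecayHalf τ ^ 2 := hqq.const_mul_left 384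
  exact ((((t1.add t2).neg_left.sub t3).add t5).add t4).congr' (Eventually.of_forall fun τ => by
    beta_reduce; rw [hform τ]) EventuallyEq.rfl

/-- `W − 1 = O(e^{−πy})`, `V = O(e^{−πy})`. [cite: CohnEtAl2019, §2.1.2 (2.8)] -/
theorem thetaW_sub_one_isBigO : (fun τ : ℍ => thetaW τ - 1) =O[atImInfty] fun τ => expDecayHalf τ := by
  have h := thetaW_second_order.trans (expDecayHalf_pow_isBigO (m := 2) (by norm_num))
  have h8 : (fun τ => 8 * qhalf τ) =O[atImInfty] fun τ => expDecayHalf τ := qhalf_isBigO.const_mul_left 8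
  exact (h.sub h8).congr_left fun τ => by ring

/-- `V = O(e^{−πy})`. [cite: CohnEtAl2019, §2.1.2 (2.8)] -/
theorem thetaV_isBigO : thetaV =O[atImInfty] fun τ => expDecayHalf τ := by
  have h := thetaV_second_order.trans (expDecayHalf_pow_isBigO (m := 3) (by norm_num))
  have h16 : (fun τ => 16 * qhalf τ) =O[atImInfty] fun τ => expDecayHalf τ := qhalf_isBigO.const_mul_left 16
  exact (h.add h16).congr_left fun τ => by ring

/-- **`ξ₂|S − ξ₄|S = O(e^{−πy})`**: `−U − V − U² − V² + 2W² = −3u − V − u² − V² + 4w + 2w²` with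
`u = U − 1`, `w = W − 1`. [cite: CohnEtAl2019, §4.4 (4.14)] -/
theorem xi2S_sub_xi4S_isBigO : (fun τ => xi2S τ - xi4S τ) =O[atImInfty] fun τ => expDecayHalf τ := by
  obtain ⟨hU1, hV1, hW1⟩ := thetaUVW_isBigO_one
  have hu := thetaU_sub_one_isBigO
  have hw := thetaW_sub_one_isBigO
  have hv := thetaV_isBigO
  have hform : ∀ τ : ℍ, xi2S τ - xi4S τ =
      -3 * (thetaU τ - 1) - thetaV τ - (thetaU τ - 1) * (thetaU τ - 1) - thetaV τ * thetaV τ +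
        4 * (thetaW τ - 1) + 2 * ((thetaW τ - 1) * (thetaW τ - 1)) := by
    intro τ
    simp only [xi2S, xi4S, Pi.add_apply, Pi.sub_apply, Pi.mul_apply, Pi.neg_apply, Pi.smul_apply, smul_eq_mul]
    ring
  have hu1 : (fun τ : ℍ => thetaU τ - 1) =O[atImInfty] fun _ : ℍ => (1 : ℝ) := hU1.sub (isBigO_const_const (1 : ℂ) one_ne_zero _)
  have hw1 : (fun τ : ℍ => thetaW τ - 1) =O[atImInfty] fun _ : ℍ => (1 : ℝ) := hW1.sub (isBigO_const_const (1 : ℂ) one_ne_zero _)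
  have t1 := hu.const_mul_left (-3)
  have t3 : (fun τ => (thetaU τ - 1) * (thetaU τ - 1)) =O[atImInfty] fun τ => expDecayHalf τ := by
    simpa using hu1.mul hu
  have t4 : (fun τ => thetaV τ * thetaV τ) =O[atImInfty] fun τ => expDecayHalf τ := by simpa using hV1.mul hv
  have t5 := hw.const_mul_left 4
  have t6 : (fun τ => 2 * ((thetaW τ - 1) * (thetaW τ - 1))) =O[atImInfty] fun τ => expDecayHalf τ := by
    simpa using (hw1.mul hw).const_mul_left 2
  exact (((((t1.sub hv).sub t3).sub t4).add t5).add t6).congr' (Eventually.of_forall fun τ => by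
    beta_reduce; rw [hform τ]) EventuallyEq.rfl

/-- **`ψ₂ − ψ₄ = O(|τ| e^{−2πy})`** — the cancellation behind (4.14) for `𝒦₋^{(8)}`:
`ψ₂ − ψ₄ = (ξ₂ − ξ₄)𝓛 + (ξ₂|S − ξ₄|S)𝓛_S`. [cite: CohnEtAl2019, §4.4 (4.14)] -/
theorem psi2_sub_psi4_isBigO :
    (fun τ => psi2 τ - psi4 τ) =O[atImInfty] fun τ : ℍ => ‖(τ : ℂ)‖ * expDecay τ := by
  have h1 : (fun τ => (xi2 τ - xi4 τ) * logLambda τ) =O[atImInfty] fun τ : ℍ => expDecayHalf τ ^ 2 * ‖(τ : ℂ)‖ :=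
    xi2_sub_xi4_isBigO.mul logLambda_isBigO
  have h2 : (fun τ => (xi2S τ - xi4S τ) * logLambdaS τ) =O[atImInfty] fun τ : ℍ => expDecayHalf τ * expDecayHalf τ :=
    xi2S_sub_xi4S_isBigO.mul logLambdaS_isBigO
  have h1' : (fun τ => (xi2 τ - xi4 τ) * logLambda τ) =O[atImInfty] fun τ : ℍ => ‖(τ : ℂ)‖ * expDecay τ :=
    h1.congr_right fun τ => by rw [expDecay_eq_sq]; ring
  have h2' : (fun τ => (xi2S τ - xi4S τ) * logLambdaS τ) =O[atImInfty] fun τ : ℍ => ‖(τ : ℂ)‖ * expDecay τ := by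
    refine h2.trans (IsBigO.of_bound 1 ?_)
    filter_upwards [eventually_one_le_norm_coe] with τ hτ
    rw [expDecay_eq_sq, Real.norm_of_nonneg (mul_nonneg (expDecayHalf_pos τ).le (expDecayHalf_pos τ).le),
      Real.norm_of_nonneg (mul_nonneg (norm_nonneg _) (sq_nonneg _)), one_mul, sq]
    nlinarith [mul_pos (expDecayHalf_pos τ) (expDecayHalf_pos τ)]
  exact (h1'.add h2').congr_left fun τ => by
    simp only [psi2, psi4, Pi.add_apply, Pi.mul_apply]; ring

/-- `ξ₄, ξ₄|S = O(1)` and **`ψ₄ = O(|τ|)`**. [cite: CohnEtAl2019, §4.2] -/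
theorem psi4_isBigO : psi4 =O[atImInfty] fun τ : ℍ => ‖(τ : ℂ)‖ := by
  obtain ⟨hU1, hV1, hW1⟩ := thetaUVW_isBigO_one
  have hxi4 : xi4 =O[atImInfty] fun _ : ℍ => (1 : ℝ) := by
    have := ((hU1.mul hU1).add (hW1.mul hW1)).sub ((hV1.mul hV1).const_mul_left 2)
    refine (this.congr_left fun τ => ?_).congr_right fun _ => by norm_num
    simp only [xi4, Pi.add_apply, Pi.sub_apply, Pi.mul_apply, Pi.smul_apply, smul_eq_mul]
  have hxi4S : xi4S =O[atImInfty] fun _ : ℍ => (1 : ℝ) := by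
    have := ((hU1.mul hU1).add (hV1.mul hV1)).sub ((hW1.mul hW1).const_mul_left 2)
    refine (this.congr_left fun τ => ?_).congr_right fun _ => by norm_num
    simp only [xi4S, Pi.add_apply, Pi.sub_apply, Pi.mul_apply, Pi.smul_apply, smul_eq_mul]
  have h1 : (fun τ => xi4 τ * logLambda τ) =O[atImInfty] fun τ : ℍ => ‖(τ : ℂ)‖ := by
    simpa using hxi4.mul logLambda_isBigO
  have h2 : (fun τ => xi4S τ * logLambdaS τ) =O[atImInfty] fun τ : ℍ => ‖(τ : ℂ)‖ := by
    have := hxi4S.mul logLambdaS_isBigO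
    refine this.trans (IsBigO.of_bound 1 ?_)
    filter_upwards [eventually_one_le_norm_coe] with τ hτ
    rw [one_mul, Real.norm_of_nonneg (expDecayHalf_pos τ).le, norm_norm, one_mul]
    exact (expDecayHalf_le_one τ).trans hτ
  exact (h1.add h2).congr_left fun τ => by simp only [psi4, Pi.add_apply, Pi.mul_apply]

/-! ## The `j`-quotients -/

/-- **`(f₂ − j)/(j − j(z)) = E₄²(E₆ − E₄)/(E₄³ − j(z)Δ) = O(e^{−2πy})`** (`f₂ = E₁₄/Δ`).
[cite: CohnEtAl2019, §2.1.1 (2.1)–(2.2)] -/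
theorem f2_sub_kleinJ_div_isBigO (z : ℍ) :
    (fun τ => (f2fun τ - kleinJ τ) * (kleinJ τ - kleinJ z)⁻¹) =O[atImInfty] expDecay := by
  have hE4 : Tendsto (⇑E₄) atImInfty (𝓝 1) := ModularForm.tendsto_E_atImInfty (by norm_num) ⟨2, rfl⟩
  have hΔ0 : Tendsto (ModularForm.discriminant : ℍ → ℂ) atImInfty (𝓝 0) := CuspFormClass.zero_at_infty CuspForm.discriminant
  have hden : Tendsto (fun τ => E₄ τ ^ 3 - kleinJ z * ModularForm.discriminant τ) atImInfty (𝓝 1) := by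
    have := (hE4.pow 3).sub (hΔ0.const_mul (kleinJ z))
    simpa using this
  have hev : ∀ᶠ τ : ℍ in atImInfty, 1 / 2 ≤ ‖E₄ τ ^ 3 - kleinJ z * ModularForm.discriminant τ‖ := by
    have := (continuous_norm.tendsto (1 : ℂ)).comp hden
    rw [norm_one] at this
    exact this.eventually (eventually_ge_nhds (by norm_num : (1 / 2 : ℝ) < 1))
  have hnum : (fun τ => E₄ τ ^ 2 * (E₆ τ - E₄ τ)) =O[atImInfty] expDecay := by
    have hb : (fun τ : ℍ => E₄ τ ^ 2) =O[atImInfty] (fun _ => (1 : ℝ)) := by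
      have := (hE4.pow 2).isBigO_one ℝ
      simpa using this
    have h64 : (fun τ => E₆ τ - E₄ τ) =O[atImInfty] expDecay :=
      (E₆_sub_one_isBigO.sub E₄_sub_one_isBigO).congr_left fun τ => by ring
    simpa using hb.mul h64
  refine IsBigO.trans (IsBigO.of_bound 2 ?_) hnum
  filter_upwards [hev, eventually_kleinJ_ne z] with τ hτ hJ
  have hne : E₄ τ ^ 3 - kleinJ z * ModularForm.discriminant τ ≠ 0 := fun h0 => by
    rw [h0, norm_zero] at hτ; norm_num at hτ
  have hΔ := ModularForm.discriminant_ne_zero τ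
  have hj : kleinJ τ = E₄ τ ^ 3 / ModularForm.discriminant τ := by
    rw [eq_div_iff hΔ]; exact (E₄_cube_eq_kleinJ_mul τ).symm
  have hJ' : kleinJ τ - kleinJ z = (E₄ τ ^ 3 - kleinJ z * ModularForm.discriminant τ) / ModularForm.discriminant τ := by
    rw [hj]; field_simp
  have hform : (f2fun τ - kleinJ τ) * (kleinJ τ - kleinJ z)⁻¹ =
      E₄ τ ^ 2 * (E₆ τ - E₄ τ) / (E₄ τ ^ 3 - kleinJ z * ModularForm.discriminant τ) := by
    have hne' : E₄ τ ^ 3 - ModularForm.discriminant τ * kleinJ z ≠ 0 := by rwa [mul_comm] at hne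
    rw [hJ', inv_div, hj]
    simp only [f2fun, E14fun, Pi.mul_apply, Pi.inv_apply]
    field_simp
  rw [hform, norm_div, div_le_iff₀ (by linarith)]
  nlinarith [norm_nonneg (E₄ τ ^ 2 * (E₆ τ - E₄ τ))]

/-- `f₂/(j − j(z)) = O(1)`. [cite: CohnEtAl2019, §2.1.1 (2.1)–(2.2)] -/
theorem f2_div_isBigO_one (z : ℍ) :
    (fun τ => f2fun τ * (kleinJ τ - kleinJ z)⁻¹) =O[atImInfty] fun _ : ℍ => (1 : ℝ) := by
  have h := f2_div_sub_one_isBigO z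
  have h1 : (fun τ => E₄ τ * E₄ τ * E₆ τ * (ModularForm.discriminant τ)⁻¹ * (kleinJ τ - kleinJ z)⁻¹ - 1) =O[atImInfty]
      fun _ : ℍ => (1 : ℝ) :=
    h.trans (IsBigO.of_bound 1 (Eventually.of_forall fun τ => by
      simp [Real.norm_of_nonneg (expDecay_pos τ).le, expDecay_le_one τ]))
  have h2 := h1.add (isBigO_const_const (1 : ℂ) one_ne_zero atImInfty)
  refine (h2.congr_left fun τ => ?_).congr_right fun _ => by norm_num
  simp only [f2fun, E14fun, Pi.mul_apply, Pi.inv_apply]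
  ring

/-! ## The bound -/

/-- **(4.14) for `𝒦₋^{(8)}`**: for fixed `z`, `𝒦₋^{(8)}(τ, z) = O(|τ| e^{−2π Im τ})` as `Im τ → ∞`.
[cite: CohnEtAl2019, §4.4 (4.14)] -/
theorem kernelMinus8_isBigO (z : ℍ) :
    (fun τ => kernelMinus8 τ z) =O[atImInfty] fun τ : ℍ => ‖(τ : ℂ)‖ * expDecay τ := by
  set c : ℂ := 1 / (2 * 1728 * (π : ℂ)) with hc
  set T₁ : ℂ := -2 * 1728 * E10fun z * psiTilde0 z with hT₁
  set A : ℂ := E8fun z * psiTilde2 z - E₆ z * psiTilde4 z with hA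
  set B₂ : ℂ := E8fun z * psiTilde2 z with hB₂
  have hJ := inv_kleinJ_sub_isBigO z
  have hE4b : (⇑E₄ : ℍ → ℂ) =O[atImInfty] fun _ : ℍ => (1 : ℝ) := ModularFormClass.bdd_at_infty E₄
  -- the three pieces
  have p1 : (fun τ => E₄ τ * T₁ * (kleinJ τ - kleinJ z)⁻¹) =O[atImInfty] fun τ : ℍ => ‖(τ : ℂ)‖ * expDecay τ := by
    have h := ((hE4b.mul hJ).const_mul_left T₁)
    have h' : (fun τ => E₄ τ * T₁ * (kleinJ τ - kleinJ z)⁻¹) =O[atImInfty] expDecay := by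
      refine (h.congr_left fun τ => by ring).congr_right fun τ => by simp
    refine h'.trans (IsBigO.of_bound 1 ?_)
    filter_upwards [eventually_one_le_norm_coe] with τ hτ
    rw [Real.norm_of_nonneg (expDecay_pos τ).le, Real.norm_of_nonneg (mul_nonneg (norm_nonneg _) (expDecay_pos τ).le),
      one_mul]
    nlinarith [expDecay_pos τ]
  have p2 : (fun τ => (psi2 τ - psi4 τ) * (f2fun τ * (kleinJ τ - kleinJ z)⁻¹) * A) =O[atImInfty]
      fun τ : ℍ => ‖(τ : ℂ)‖ * expDecay τ := by
    have := (psi2_sub_psi4_isBigO.mul (f2_div_isBigO_one z)).const_mul_left A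
    refine (this.congr_left fun τ => by ring).congr_right fun τ => by ring
  have p3 : (fun τ => psi4 τ * ((f2fun τ - kleinJ τ) * (kleinJ τ - kleinJ z)⁻¹ * A +
      1728 * B₂ * (kleinJ τ - kleinJ z)⁻¹)) =O[atImInfty] fun τ : ℍ => ‖(τ : ℂ)‖ * expDecay τ := by
    have hin : (fun τ => (f2fun τ - kleinJ τ) * (kleinJ τ - kleinJ z)⁻¹ * A + 1728 * B₂ * (kleinJ τ - kleinJ z)⁻¹)
        =O[atImInfty] expDecay := by
      have h1 := ((f2_sub_kleinJ_div_isBigO z).const_mul_left A)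
      have h2 := hJ.const_mul_left (1728 * B₂)
      exact (h1.add h2).congr_left fun τ => by ring
    exact psi4_isBigO.mul hin
  have total := ((p1.add p2).add p3).const_mul_left (c / ModularForm.discriminant z)
  refine total.congr' ?_ EventuallyEq.rfl
  filter_upwards [eventually_kleinJ_ne z] with τ hJne
  have hΔz := ModularForm.discriminant_ne_zero z
  simp only [kernelMinus8, hc, hT₁, hA, hB₂]
  field_simp
  ring

end Literature.NumberTheory.ModularForms
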